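import Summits.CriticalPhenomena.SAWScalingLimit.Theorems.SAWTensorRGRestrictionOfLimitStubDomination

/-!
# Towards `stub_noAvoidanceLoss`: the interior part of the avoidance mass passes to the limit

Helper file (`--supports stmt-CriticalPhenomena-0773`) of the line `birth` for the crux `RestrictionOfLimit`
(shared verbatim by the routes SAWConePseudogroup / SAWConfRestriction / SAWBrownianDomination / SAWTowerCount /
SAWTensorRG). Notation of the line: `P` a full scaling limit of the critical `δℤ²` SAW
(`SAW.IsScalingLimitFamily P`), Dobrushin `D' ⊆ D` with the same marked points, `(a_δ, b_δ)` an endpoint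
approximation of `D'`, `S_δ = {γ : SAW(D_δ; a_δ, b_δ) | every edge of γ is an edge of D'_δ}`,
`p_δ = P_{D,δ}(S_δ)`, `R = CurveClass.rangeSubset (closure D')`, and the HARD stub S3
(`stub_noAvoidanceLoss`): `P D (R) ≤ liminf_{δ→0⁺} p_δ`.

This file proves the part of S3 that portmanteau DOES give, and isolates the remainder as one null set.
Let `F := closure (D ∖ D')` (the closed-up part of `D` removed by `D'`: the interior boundary arc
`∂D' ∩ D`, the hull `D ∖ cl D'`, and their feet on `∂D`).

* `forall_edges_mem_edgeSet_of_range_subset` — THE LATTICE INCLUSION, thin-layer free: a walk of `D_δ`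
  starting at a vertex of `D'_δ` whose polyline avoids `F` is a walk of `D'_δ` (its vertices are mesh points of
  `D ∖ F ⊆ D'`, its closed edges lie in `cl D ∖ F ⊆ cl D'`, and it never leaves the component of its starting
  point in the mesh graph of `D'`). No positivity of the mesh is needed.
* `measure_rangeSubset_compl_le_liminf` / registered stub `stub_interiorAvoidance` — **S3b, the interior part passes**:
  `P D {γ | range γ ∩ F = ∅} ≤ liminf_{δ→0⁺} p_δ` — the event is OPEN (`CurveClass.isClosed_hitsBefore_empty_right`),
  portmanteau (`le_liminf_law_preimage_of_isOpen`) and the lattice inclusion.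
* `noAvoidanceLoss_of_nullTouch` — **S3 ⟸ NullTouch**: if the limit law in `D` gives zero mass to the curves
  that stay in `cl D'` AND touch `F`, then `P D (R) ≤ liminf p_δ` (S3 for this pair and this endpoint
  approximation). So the whole analytic content of S3 — hence of the crux, given S1 + S2 — is the null set
  `R ∩ {γ | range γ ∩ closure (D ∖ D') ≠ ∅}` under `P D`: no touching-without-crossing of `cl(∂D' ∩ D)` and no
  crawling on `∂D` at its feet, for an ABSTRACT limit `P` (true for the SLE_{8/3} family when `D ∖ D'` is a
  hull bounded away from `a`, `b`, LSW03 arXiv:math/0209343 §2; not expected in general when `D ∖ D'`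
  accumulates at a marked point, where S3 needs a different decomposition).
* `noAvoidanceLoss_of_measure_rangeSubset_eq_zero` — the degenerate case `P D (R) = 0` (pinched / tangential
  sub-domains for an SLE-type limit) is free.

References: G. F. Lawler, O. Schramm, W. Werner, *On the scaling limit of planar self-avoiding walk* (2004),
§3.4.5 p. 14 ("restricted to walks that stay in `N D'` (in the appropriate sense)"); Mathlib portmanteau.
No named fact is used; axioms `propext`, `Classical.choice`, `Quot.sound`.
-/

noncomputable section

open MeasureTheory Filter Topology Set Metric
open Literature.Probability.RandomPlanarGeometry Literature.Probability.LatticeModels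
open scoped ENNReal NNReal

namespace Summit.CriticalPhenomena.SAWScalingLimit.Theorems.RestrictionOfLimit.Birth

/-! ### The lattice inclusion: avoiding `closure (D ∖ D')` forces the walk into `D'_δ` -/

/-- `cl Ω ⊆ cl Ω' ∪ cl (Ω ∖ Ω')`: a point of `cl Ω` off `closure (Ω ∖ Ω')` lies in `cl Ω'` (no nesting
of `Ω'` in `Ω` is needed). [folklore] -/
theorem mem_closure_of_mem_closure_of_notMem {Ω Ω' : Set ℂ} {z : ℂ}
    (hz : z ∈ closure Ω) (hzF : z ∉ closure (Ω \ Ω')) : z ∈ closure Ω' := by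
  have h : closure Ω ⊆ closure Ω' ∪ closure (Ω \ Ω') := by
    rw [← closure_union]
    exact closure_mono fun w hw => (em (w ∈ Ω')).elim Or.inl fun h => Or.inr ⟨hw, h⟩
  exact (h hz).resolve_right hzF

/-- A point of `Ω` off `closure (Ω ∖ Ω')` lies in `Ω'`. [folklore] -/
theorem mem_of_mem_of_notMem_closure_diff {Ω Ω' : Set ℂ} {z : ℂ} (hz : z ∈ Ω)
    (hzF : z ∉ closure (Ω \ Ω')) : z ∈ Ω' := by
  by_contra h
  exact hzF (subset_closure ⟨hz, h⟩)

/-- **The lattice inclusion (no thin layer).** A walk of `Ω_δ = discreteDomainGraph Ω δ` that starts at a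
vertex of `Ω'_δ = meshDomain Ω' δ` and whose polyline avoids `closure (Ω ∖ Ω')` is a walk of `Ω'_δ`: every
one of its edges is an edge of `discreteDomainGraph Ω' δ` (no nesting `Ω' ⊆ Ω` is needed). Induction along the walk: the
closed first edge lies in the polyline, hence in `cl Ω ∖ cl(Ω ∖ Ω') ⊆ cl Ω'`, its far end is a mesh point of
`Ω ∖ cl(Ω ∖ Ω') ⊆ Ω'`, so the edge is an edge of the mesh graph of `Ω'` on its mesh vertices, and `meshDomain`
is saturated under such adjacencies (`mem_meshDomain_of_adj`). (LSW 2004 §3.4.5: "walks that stay in `N D'`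
(in the appropriate sense)".) [folklore] -/
theorem forall_edges_mem_edgeSet_of_range_subset {Ω Ω' : Set ℂ} {δ : ℝ} :
    ∀ {x y : Site 2} (p : (discreteDomainGraph Ω δ).Walk x y), x ∈ meshDomain Ω' δ →
      Set.range (p.toCurve (meshPoint δ)) ⊆ (closure (Ω \ Ω'))ᶜ →
        ∀ e ∈ p.edges, e ∈ (discreteDomainGraph Ω' δ).edgeSet
  | _, _, SimpleGraph.Walk.nil, _, _ => by simp
  | x, _, SimpleGraph.Walk.cons (v := v) h p, hx, hr => by
    rw [SubseqIdentification.Negative.walk_range_toCurve_cons, union_subset_iff] at hr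
    obtain ⟨hseg, hrp⟩ := hr
    obtain ⟨hmesh, -, hvD⟩ := discreteDomainGraph_adj_iff.1 h
    obtain ⟨hzd, hsegΩ⟩ := meshGraph_adj_iff.1 hmesh
    -- the far end `v` is a mesh vertex of `Ω'`
    have hxv : x ∈ meshVertices Ω' δ := meshDomain_subset_meshVertices Ω' δ hx
    have hvv : v ∈ meshVertices Ω' δ :=
      mem_of_mem_of_notMem_closure_diff (meshDomain_subset_meshVertices Ω δ hvD)
        (hseg (right_mem_segment ℝ _ _))
    -- the closed edge lies in `cl Ω'`
    have hseg' : segment ℝ (meshPoint δ x) (meshPoint δ v) ⊆ closure Ω' := fun z hz =>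
      mem_closure_of_mem_closure_of_notMem (hsegΩ hz) (hseg hz)
    have hmesh' : (meshGraph Ω' δ).Adj x v := meshGraph_adj_iff.2 ⟨hzd, hseg'⟩
    -- `meshDomain Ω' δ` is saturated under mesh adjacency on mesh vertices
    have hv : v ∈ meshDomain Ω' δ := by
      have hadj : (meshVertexGraph Ω' δ).Adj ⟨x, hxv⟩ ⟨v, hvv⟩ := by
        simpa only [SimpleGraph.comap_adj, Function.Embedding.subtype_apply] using hmesh'
      exact mem_meshDomain_of_adj hx hadj
    have he : s(x, v) ∈ (discreteDomainGraph Ω' δ).edgeSet :=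
      (SimpleGraph.mem_edgeSet _).2 (discreteDomainGraph_adj_iff.2 ⟨hmesh', hx, hv⟩)
    intro e he'
    rw [SimpleGraph.Walk.edges_cons, List.mem_cons] at he'
    rcases he' with rfl | he'
    · exact he
    · exact forall_edges_mem_edgeSet_of_range_subset p hv hrp e he'

/-- A vertex joined in `Ω_δ` to a DIFFERENT vertex belongs to `meshDomain Ω δ` (the first edge of a
joining walk is an edge of `Ω_δ`). [folklore] -/
theorem mem_meshDomain_of_reachable_ne {Ω : Set ℂ} {δ : ℝ} {x y : Site 2} (hxy : x ≠ y)
    (h : (discreteDomainGraph Ω δ).Reachable x y) : x ∈ meshDomain Ω δ := by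
  obtain ⟨p⟩ := h
  cases p with
  | nil => exact absurd rfl hxy
  | cons h _ => exact (discreteDomainGraph_adj_iff.1 h).2.1

/-- **The lattice inclusion for SAWs, at a good mesh**: if `a ≠ b` are joined in `D'_δ` (so `a ∈ D'_δ`),
then every SAW of `D_δ` from `a` to `b` whose curve lies in `rangeSubset (closure (D ∖ D'))ᶜ` has all its
edges in `D'_δ`, i.e. `{curve ∈ rangeSubset Fᶜ} ⊆ S_δ`. [folklore] -/
theorem preimage_curve_rangeSubset_compl_subset {Ω Ω' : Set ℂ} {δ : ℝ} {a b : Site 2}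
    (hab : a ≠ b) (hreach : (discreteDomainGraph Ω' δ).Reachable a b) :
    (fun γ : SAW.DomainSAW Ω δ a b => γ.curve) ⁻¹'
        CurveClass.rangeSubset (closure (Ω \ Ω'))ᶜ ⊆
      {γ : SAW.DomainSAW Ω δ a b | ∀ e ∈ γ.walk.edges, e ∈ (discreteDomainGraph Ω' δ).edgeSet} := by
  intro γ hγ
  rw [mem_preimage, CurveClass.mem_rangeSubset] at hγ
  exact forall_edges_mem_edgeSet_of_range_subset γ.walk
    (mem_meshDomain_of_reachable_ne hab hreach) (by rintro _ ⟨t, rfl⟩; exact hγ ⟨t, rfl⟩)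

/-! ### S3b: the interior part of the avoidance mass passes to the limit -/

/-- Avoiding a closed set is an OPEN event of curve classes (the trace is compact):
`rangeSubset Fᶜ` is open for closed `F` (`CurveClass.isClosed_hitsBefore_empty_right`). [folklore] -/
theorem isOpen_rangeSubset_compl {F : Set ℂ} (hF : IsClosed F) :
    IsOpen (CurveClass.rangeSubset Fᶜ : Set (CurveClass ℂ)) := by
  have h := CurveClass.isClosed_hitsBefore_empty_right (E := ℂ) hF
  rw [CurveClass.hitsBefore_empty_right] at h
  exact isClosed_compl_iff.1 h

variable {P : ChordalFamily}

/-- **S3b — the interior part of the avoidance mass passes to the limit** (the half of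
`stub_noAvoidanceLoss` that portmanteau gives). For a full scaling-limit family `P`, Dobrushin `D' ⊆ D`
with the same marked points and an endpoint approximation `(a_δ, b_δ)` of `D'`:
`P D {γ | range γ ∩ closure (D ∖ D') = ∅} ≤ liminf_{δ→0⁺} P_{D,δ}[the walk is a walk of D'_δ]`.
Proof: the event is open, so (PO) `P D (U) ≤ liminf P_{D,δ}(curve ∈ U)`
(`le_liminf_law_preimage_of_isOpen`, `(a_δ, b_δ)` being an endpoint approximation of `D` too), and
eventually `{curve ∈ U} ⊆ S_δ` (`preimage_curve_rangeSubset_compl_subset` on the good meshes of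
`eventually_lattice_bookkeeping`). [folklore] -/
theorem measure_rangeSubset_compl_le_liminf (hP : SAW.IsScalingLimitFamily P) {D D' : DobrushinDomain}
    (hsub : D'.carrier ⊆ D.carrier) (h0 : D'.pt 0 = D.pt 0) (h1 : D'.pt 1 = D.pt 1)
    {a b : ℝ → Site 2} (hab : SAW.IsEndpointApprox D' a b) :
    P D (CurveClass.rangeSubset (closure (D.carrier \ D'.carrier))ᶜ) ≤
      liminf (fun δ : ℝ => SAW.law D.carrier δ (a δ) (b δ)
        {γ : SAW.DomainSAW D.carrier δ (a δ) (b δ) |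
          ∀ e ∈ γ.walk.edges, e ∈ (discreteDomainGraph D'.carrier δ).edgeSet}) (𝓝[>] (0 : ℝ)) := by
  have habD : SAW.IsEndpointApprox D a b :=
    IsingBoundaryRatio.Negative.isEndpointApprox_of_subdomain hab hsub h0 h1
  refine (le_liminf_law_preimage_of_isOpen hP habD (isOpen_rangeSubset_compl isClosed_closure)).trans
    (liminf_le_liminf ?_)
  filter_upwards [eventually_lattice_bookkeeping hsub hab] with δ ⟨_, hne, hreach, _, _⟩
  exact measure_mono (preimage_curve_rangeSubset_compl_subset hne hreach)

/-- **Registered stub `stub_interiorAvoidance` (S3b of the reshaped line `birth`) — interior avoidance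
passes to the limit**, verbatim the registered signature: for every full scaling-limit family `P`, all
Dobrushin `D' ⊆ D` with the same marked points and every endpoint approximation `(a_δ, b_δ)` of `D'`,
`P D (rangeSubset (closure (D ∖ D'))ᶜ) ≤ liminf_{δ→0⁺} P_{D,δ}[the walk is a walk of D'_δ]`
(`measure_rangeSubset_compl_le_liminf`). [folklore] -/
theorem stub_interiorAvoidance :
    ∀ P : ChordalFamily, SAW.IsScalingLimitFamily P →
      ∀ (D D' : DobrushinDomain), D'.carrier ⊆ D.carrier → D'.pt 0 = D.pt 0 → D'.pt 1 = D.pt 1 →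
        ∀ (a b : ℝ → Site 2), SAW.IsEndpointApprox D' a b →
          P D (CurveClass.rangeSubset (closure (D.carrier \ D'.carrier))ᶜ) ≤
            Filter.liminf (fun δ : ℝ => SAW.law D.carrier δ (a δ) (b δ)
                {γ : SAW.DomainSAW D.carrier δ (a δ) (b δ) |
                  ∀ e ∈ γ.walk.edges, e ∈ (discreteDomainGraph D'.carrier δ).edgeSet})
              (𝓝[>] (0 : ℝ)) :=
  fun _ hP _ _ hsub h0 h1 _ _ hab => measure_rangeSubset_compl_le_liminf hP hsub h0 h1 hab

/-! ### S3 from a null-touching hypothesis; the degenerate case -/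

/-- `R ⊆ (R ∩ Touch) ∪ {range ∩ F = ∅}`: a curve staying in `cl D'` either touches `F` or avoids it.
[folklore] -/
theorem rangeSubset_subset_inter_union (S F : Set ℂ) :
    (CurveClass.rangeSubset S : Set (CurveClass ℂ)) ⊆
      (CurveClass.rangeSubset S ∩ {γ | (γ.range ∩ F).Nonempty}) ∪ CurveClass.rangeSubset Fᶜ := by
  intro γ hγ
  by_cases h : (γ.range ∩ F).Nonempty
  · exact Or.inl ⟨hγ, h⟩
  · refine Or.inr (CurveClass.mem_rangeSubset.2 fun z hz hzF => h ⟨z, hz, hzF⟩)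

/-- **S3 ⟸ NullTouch.** If the limit law in `D` gives zero mass to the curves staying in `cl D'` that
touch `closure (D ∖ D')`, then `P D {γ ⊆ cl D'} ≤ liminf_{δ→0⁺} P_{D,δ}[the walk is a walk of D'_δ]`,
i.e. `stub_noAvoidanceLoss` holds for this scaling-limit family, this pair of domains and this endpoint
approximation. Hence, given S1 + S2 (landed), the crux `RestrictionOfLimit` for the pair `(D, D')` reduces
to the single null set `{γ ⊆ cl D'} ∩ {range γ ∩ closure (D ∖ D') ≠ ∅}` under `P D` — null touching of the
removed part by an abstract SAW limit, which is the open analytic content (LSW 2004 §3.4.5 "in the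
appropriate sense"; LSW 2003 §2 for hulls off the marked points on the SLE_{8/3} side). [folklore] -/
theorem noAvoidanceLoss_of_nullTouch (hP : SAW.IsScalingLimitFamily P) {D D' : DobrushinDomain}
    (hsub : D'.carrier ⊆ D.carrier) (h0 : D'.pt 0 = D.pt 0) (h1 : D'.pt 1 = D.pt 1)
    {a b : ℝ → Site 2} (hab : SAW.IsEndpointApprox D' a b)
    (hnull : P D (CurveClass.rangeSubset (closure D'.carrier) ∩
      {γ | (γ.range ∩ closure (D.carrier \ D'.carrier)).Nonempty}) = 0) :
    P D (CurveClass.rangeSubset (closure D'.carrier)) ≤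
      liminf (fun δ : ℝ => SAW.law D.carrier δ (a δ) (b δ)
        {γ : SAW.DomainSAW D.carrier δ (a δ) (b δ) |
          ∀ e ∈ γ.walk.edges, e ∈ (discreteDomainGraph D'.carrier δ).edgeSet}) (𝓝[>] (0 : ℝ)) :=
  calc P D (CurveClass.rangeSubset (closure D'.carrier))
      ≤ P D ((CurveClass.rangeSubset (closure D'.carrier) ∩
            {γ | (γ.range ∩ closure (D.carrier \ D'.carrier)).Nonempty}) ∪
          CurveClass.rangeSubset (closure (D.carrier \ D'.carrier))ᶜ) :=
        measure_mono (rangeSubset_subset_inter_union _ _)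
    _ ≤ P D (CurveClass.rangeSubset (closure D'.carrier) ∩
            {γ | (γ.range ∩ closure (D.carrier \ D'.carrier)).Nonempty}) +
          P D (CurveClass.rangeSubset (closure (D.carrier \ D'.carrier))ᶜ) := measure_union_le _ _
    _ = P D (CurveClass.rangeSubset (closure (D.carrier \ D'.carrier))ᶜ) := by rw [hnull, zero_add]
    _ ≤ _ := measure_rangeSubset_compl_le_liminf hP hsub h0 h1 hab

/-- **The degenerate case of S3 is free**: if `P D {γ ⊆ cl D'} = 0` (e.g. sub-domains pinched or tangent
at a marked point for an SLE-type limit), `stub_noAvoidanceLoss` holds trivially for the pair. [folklore] -/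
theorem noAvoidanceLoss_of_measure_rangeSubset_eq_zero {D D' : DobrushinDomain} {a b : ℝ → Site 2}
    (h : P D (CurveClass.rangeSubset (closure D'.carrier)) = 0) :
    P D (CurveClass.rangeSubset (closure D'.carrier)) ≤
      liminf (fun δ : ℝ => SAW.law D.carrier δ (a δ) (b δ)
        {γ : SAW.DomainSAW D.carrier δ (a δ) (b δ) |
          ∀ e ∈ γ.walk.edges, e ∈ (discreteDomainGraph D'.carrier δ).edgeSet}) (𝓝[>] (0 : ℝ)) := by
  rw [h]
  exact bot_le

end Summit.CriticalPhenomena.SAWScalingLimit.Theorems.RestrictionOfLimit.Birth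

end
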